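/-
Copyright (c) 2026 the pub-hodgecm-mathlib formalisation cell (harness21).  Prover seat hodgecm-mathlib-LH4-p08 (g8), req620 Track A «(D-RAM) FOUR-FRAME» squad, helper lane
on h413 = stmt-HodgeConjecture-24833 (count-neutral).  STAGE-1b: THE THREE ROW-(3) `hnum` LETTERS OF THE (H-·) STUBS AT THE ROW-(1) CONSTANT OF RECORD (LH4-p06 (g6) 11:15:05Z
«YES, TAKE hnum»; dealer∕pen LH4-plan (g13) WORD #60).  2026-09-04.
-/
import Summits.HodgeConjecture.HodgeConjecture.Theorems.F0P3cDyRamCoefAffineRowThreeNumber        -- ★ p859583 (this lineage): `coefAffine_rowThree_number_eq`; brings ★ `support_hFamily_zero`, ★ `measureReal_support_hFamily_ne_zero`, ★ `hFamily`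
import Summits.HodgeConjecture.HodgeConjecture.Theorems.F0P3cDyRamLeviExponentsOfRecord           -- ★ p859652 (LH4-p10 (g6)): `leviExp_laLow∕zero∕laHigh_mstarOfRecord`; brings ★ DEFS LEAF №5 `laLow∕laHighOfRecord`, `csOfRecord`, `klOfRecord`, ★ №3 `mstarOfRecord`, `dOfPlace`
import Summits.HodgeConjecture.HodgeConjecture.Theorems.F0P3cDyRamDOfPlaceOfDatum                 -- ★ (LH4-p02 (g12)): `dOfPlace_eq_of_isRamifiedQuadraticDatum`
import Summits.HodgeConjecture.HodgeConjecture.Theorems.F0P3cDyRamFixedPointCensusTypeTwoPrelude   -- ★ (LH4-p14 lineage): `natCard_quot_eq_card_residueField` (`q_v = q_w` at a ramified non-split place)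
import HarnessLib

/-!
# Crux `H413`, line LH4 «(D-RAM) FOUR-FRAME» — STAGE-1b: THE ROW-(3) `hnum` LETTERS OF `stub_hside_levLo ∕ levHi ∕ sq` AT THE ROW-(1) CONSTANT OF RECORD

Cell `hodgecm-mathlib` (D-0151), FLOOR 0, crux item H413 = `stmt-HodgeConjecture-24833`, route of record `HCCMUnconditional`; squad F0∕P3c∕LH4 (req618∕req620); helper lane
`--supports stmt-HodgeConjecture-24833 --as helper` (count-neutral).  THEOREMS ONLY (no `def`, no instance, no notation, no `sorry`; default heartbeats).

WHAT.  ★ p859630 `F0P3cDyRamHSideTriplesOfRecordOfRows` (LH4-p06 (g6)) states each of the three registered (H-·) stubs of the tier-0 line ED. 5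
(`stub_hside_levLo ∕ stub_hside_levHi ∕ stub_hside_sq`) from ONE per-place letter `hrows : ∀ place, ∃ cA cB N₁, hA ∧ hG₂ ∧ hnum`.  THIS FILE discharges the third
conjunct `hnum` — the Levi scalar identity of ★ (V5-lev) `rowThree_levels_hFamily_of_scalar`, `coef 0·ν_0 + coef 1·ν_1 = q_v^{−e(a,b;d)}·(νG₃(K)∕νH(K_H))·ν_0` with
`coef := coefAffine(cA, cB)` — VERBATIM at the three schedules of record and at the row-(1) constant of record
`cA := (νG₃ K).toReal · (2·q_w^{−ks})` (`ks := csOfRecord d` for lo ∕ sq, `klOfRecord d` for hi; this is ★ (V7) `affine_token_of_amplShift`'s `cA` at `C := (νG₃ K).toReal`),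
for EVERY `cB`: so the (H-pen) picks one pair `(cA, cB)` for rows (1) and (3) and the stub reads `…_of_rows (fun place => ⟨cA, cB, N₁, ★ (V7) …, ‹hG₂›, hnum_…_ofRecord …⟩)`.
PROOF (scalar arithmetic over ★ only): the row-(3) number of `coefAffine(cA, cB)` is `cA∕2` whatever `cB` (★ p859583 `coefAffine_rowThree_number_eq`, two-germ rigidity);
`supp hFamily 0 = K_H` (★ `support_hFamily_zero`) and `νH(K_H) ≠ 0` (★ `measureReal_support_hFamily_ne_zero`) cancel the H-volume; `dOfPlace L v w = d` (★
`dOfPlace_eq_of_isRamifiedQuadraticDatum`); the Levi fibre-volume exponents at the schedules of record are `e(ℓ_lo, m*; d) = csOfRecord d`, `e(ℓ_hi, m*; d) = klOfRecord d`,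
`e(0, m*; d) = csOfRecord d` (★ p859652 — the «𝒜 = ρ» consistency of the amplitude normalisation with the Levi row); `q_v = q_w` at a ramified non-split place (★
`natCard_quot_eq_card_residueField`, `f(w|v) = 1`).

* `hnum_levLo_ofRecord` — `(a, b) = (laLowOfRecord, mstarOfRecord) ∘ dOfPlace`, `ks = csOfRecord d`.
* `hnum_levHi_ofRecord` — `(a, b) = (laHighOfRecord, mstarOfRecord) ∘ dOfPlace`, `ks = klOfRecord d`.
* `hnum_sq_ofRecord`    — `(a, b) = (0, mstarOfRecord ∘ dOfPlace)`, `ks = csOfRecord d`.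
HONEST LABEL.  Count-neutral (`--supports`): pays no registered stub by itself and touches no `Lines/` module (the (H-pen) LH4-p06 (g6) composes «stub ⇐ (hΩ) ∧ (hG₂)»);
the seven tier-0 ED. 5 sorries stay OPEN; `HC_CM` is proved only modulo the 7 printed citations (2 remaining named inputs: hLiu418 = `stmt-HodgeConjecture-24832`, h413 =
`stmt-HodgeConjecture-24833`) until rung 0 closes.

## References
* [Rogawski1990] J. D. Rogawski, *Automorphic Representations of Unitary Groups in Three Variables*, Ann. of Math. Stud. 123 (1990): §4.9 Prop. 4.9.1 (a)(b) p. 55,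
  Lemma 4.9.2 p. 56; §4.3 (4.3.1) p. 43.
* [Kottwitz1986BaseChangeUnits] R. E. Kottwitz, *Base change for unit elements of Hecke algebras*, Compositio Math. 60 (1986), §1 pp. 240–241.
* [NeukirchANT1999] J. Neukirch, *Algebraic Number Theory*, Grundlehren 322 (1999), Ch. I §8 Prop. (8.2); Ch. II §4 Prop. (4.3) (`f(w|v) = 1` at a ramified quadratic place).
-/

set_option autoImplicit false

noncomputable section

namespace Summit.HodgeConjecture.HodgeConjecture.Cruxes.H413.F0P3cDyRamHSideRowThreeLettersOfRecord

open MeasureTheory Measure NumberField IsDedekindDomain Topology Filter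
open Literature.NumberTheory.Automorphic Literature.NumberTheory.Automorphic.UnitaryGroup Literature.NumberTheory.Automorphic.IntegralReduction
open Literature.NumberTheory.Automorphic.UnitaryLatticeTree Literature.NumberTheory.Automorphic.HermitianLattice
open Literature.NumberTheory.Rogawski1990 Literature.NumberTheory.GaloisRepresentations
open scoped Matrix MatrixGroups Classical ValuativeRel WithZero
open Literature.NumberTheory.Automorphic.UnitaryThreeFourFrame
open Summit.HodgeConjecture.HodgeConjecture.Cruxes.H413.F0P3cDyRamFourFramePieces
open Summit.HodgeConjecture.HodgeConjecture.Cruxes.H413.F0P3cDyRamFourFrameHFamilyDefs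
open Summit.HodgeConjecture.HodgeConjecture.Cruxes.H413.F0P3cDyRamStageOneBDefs
open Summit.HodgeConjecture.HodgeConjecture.Cruxes.H413.F0P3cDyRamRowThreeReduction
open Summit.HodgeConjecture.HodgeConjecture.Cruxes.H413.F0P3cDyRamCoefAffineRowThreeNumber
open Summit.HodgeConjecture.HodgeConjecture.Cruxes.H413.F0P3cDyRamLeviExponentsOfRecord
open Summit.HodgeConjecture.HodgeConjecture.Cruxes.H413.F0P3cDyRamDOfPlaceOfDatum
open Summit.HodgeConjecture.HodgeConjecture.Cruxes.H413.F0P3cDyRamFixedPointCensusTypeTwoPrelude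

/-- **(hnum-lev-lo) · THE ROW-(3) LETTER OF `stub_hside_levLo` AT THE ROW-(1) CONSTANT OF RECORD.**  The third conjunct of ★ p859630
`hSideLevelsTripleS_lo_of_rows`'s per-place letter `hrows` — the Levi scalar identity of ★ (V5-lev) at `(a, b) := (laLowOfRecord (dOfPlace L v w), mstarOfRecord (dOfPlace L v w))`,
`coef := coefAffine(cA, cB)` — holds VERBATIM, for every `cB`, at `cA := νG₃(K)·2·q_w^{−csOfRecord d}` (★ (V7) `affine_token_of_amplShift`'s `cA` at `C := (νG₃ K).toReal`,
`ks := csOfRecord d`), so ONE pair `(cA, cB)` serves rows (1) and (3).  Proof: the row-(3) number of `coefAffine(cA, cB)` is `cA∕2` (★ p859583); `supp hFamily 0 = K_H`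
(★ `support_hFamily_zero`) cancels `νH(K_H) ≠ 0`; `dOfPlace L v w = d` (★ `dOfPlace_eq_of_isRamifiedQuadraticDatum`); the Levi fibre-volume exponent
`e(laLowOfRecord d, mstarOfRecord d; d) = csOfRecord d` (★ p859652 `leviExp_laLow_mstarOfRecord` — «𝒜 = ρ»); `q_v = q_w` at a ramified place (★ `natCard_quot_eq_card_residueField`).
[cite: Rogawski1990, §4.9 Prop. 4.9.1 (a)(b) p. 55, Lemma 4.9.2 p. 56] [cite: Kottwitz1986BaseChangeUnits, §1 pp. 240–241] -/
theorem hnum_levLo_ofRecord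
    (L : Type) [Field L] [NumberField L] [IsCMField L]
    {v : HeightOneSpectrum (𝓞 ↥(maximalRealSubfield L))} (w : UnitaryGroup.PlacesOver L v)
    (hw : IsCMField.complexConj L • w.1 = w.1) (he : v.asIdeal.ramificationIdx' w.1.asIdeal ≠ 1)
    (ϖ : (w.1.adicCompletion L)) (hϖ : Valued.v ϖ = WithZero.exp (-1 : ℤ)) (d tE : ℕ)
    (hD : IsRamifiedQuadraticDatum (galAdicCompletionMap (L := L) (IsCMField.complexConj L) hw) ϖ d tE)
    [Fintype (Valued.ResidueField (w.1.adicCompletion L))]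
    [MeasurableSpace ((UnitaryGroup.cmDatum L 3 (Matrix.of fun i j : Fin 3 => if i.val + j.val + 1 = 3 then (1 : L) else 0)).Local v)]
    [MeasurableSpace ((UnitaryGroup.cmDatum L 2 (Matrix.of fun i j : Fin 2 => if i.val + j.val + 1 = 2 then (1 : L) else 0)).Local v × (UnitaryGroup.cmDatum L 1 (Matrix.of fun i j : Fin 1 => if i.val + j.val + 1 = 1 then (1 : L) else 0)).Local v)] [BorelSpace ((UnitaryGroup.cmDatum L 2 (Matrix.of fun i j : Fin 2 => if i.val + j.val + 1 = 2 then (1 : L) else 0)).Local v × (UnitaryGroup.cmDatum L 1 (Matrix.of fun i j : Fin 1 => if i.val + j.val + 1 = 1 then (1 : L) else 0)).Local v)]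
    (νH : Measure ((UnitaryGroup.cmDatum L 2 (Matrix.of fun i j : Fin 2 => if i.val + j.val + 1 = 2 then (1 : L) else 0)).Local v × (UnitaryGroup.cmDatum L 1 (Matrix.of fun i j : Fin 1 => if i.val + j.val + 1 = 1 then (1 : L) else 0)).Local v)) [νH.IsHaarMeasure]
    (νG₃ : Measure ((UnitaryGroup.cmDatum L 3 (Matrix.of fun i j : Fin 3 => if i.val + j.val + 1 = 3 then (1 : L) else 0)).Local v)) (cB : ℂ) :
              ((fun s : Fin 2 => if ((s : Fin 2) : ℕ) = d % 2 then ((((νG₃ (cmLocalIntegralLevel L 3 (Matrix.of fun i j : Fin 3 => if i.val + j.val + 1 = 3 then (1 : L) else 0) v : Set ((UnitaryGroup.cmDatum L 3 (Matrix.of fun i j : Fin 3 => if i.val + j.val + 1 = 3 then (1 : L) else 0)).Local v))).toReal : ℂ) * ((2 * (Fintype.card (Valued.ResidueField (w.1.adicCompletion L)) : ℚ) ^ (-(csOfRecord d : ℤ)) : ℚ) : ℂ)) + cB) / (2 * (νH.real (Function.support (hFamily L w hw ϖ s)) : ℂ)) else -cB / (2 * (νH.real (Function.support (hFamily L w hw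 ϖ s)) : ℂ))) 0 * (νH.real (Function.support (hFamily L w hw ϖ 0)) : ℂ) + (fun s : Fin 2 => if ((s : Fin 2) : ℕ) = d % 2 then ((((νG₃ (cmLocalIntegralLevel L 3 (Matrix.of fun i j : Fin 3 => if i.val + j.val + 1 = 3 then (1 : L) else 0) v : Set ((UnitaryGroup.cmDatum L 3 (Matrix.of fun i j : Fin 3 => if i.val + j.val + 1 = 3 then (1 : L) else 0)).Local v))).toReal : ℂ) * ((2 * (Fintype.card (Valued.ResidueField (w.1.adicCompletion L)) : ℚ) ^ (-(csOfRecord d : ℤ)) : ℚ) : ℂ)) + cB) / (2 * (νH.real (Function.support (hFamily L w hw ϖ s)) : ℂ)) else -cB / (2 * (νH.real (Function.support (hFamily L w hw ϖ s)) : ℂ))) 1 * (νH.real (Function.support (hFamily L w hw ϖ 1)) : ℂ) =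
          ((((Ideal.absNorm v.asIdeal : ℝ) ^ ((max (max (laLowOfRecord (dOfPlace L v w)) (((mstarOfRecord (dOfPlace L v w)) + 1) / 2)) (((laLowOfRecord (dOfPlace L v w)) + d) / 2) - d / 2) + ((laLowOfRecord (dOfPlace L v w)) - d % 2 + 1) / 2))⁻¹) : ℂ) *
          (((νG₃.real (cmLocalIntegralLevel L 3 (Matrix.of fun i j : Fin 3 => if i.val + j.val + 1 = 3 then (1 : L) else 0) v : Set ((cmDatum L 3 (Matrix.of fun i j : Fin 3 => if i.val + j.val + 1 = 3 then (1 : L) else 0)).Local v)) : ℂ) /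
            (νH.real ((((cmLocalIntegralLevel L 2 (Matrix.of fun i j : Fin 2 => if i.val + j.val + 1 = 2 then (1 : L) else 0) v).prod
              (cmLocalIntegralLevel L 1 (Matrix.of fun i j : Fin 1 => if i.val + j.val + 1 = 1 then (1 : L) else 0) v) : Subgroup _) : Set _)) : ℂ)) *
          (νH.real (Function.support (hFamily L w hw ϖ 0)) : ℂ))) := by
  have hν := measureReal_support_hFamily_ne_zero L w hw he ϖ hϖ νH 0
  rw [coefAffine_rowThree_number_eq L w hw he ϖ hϖ νH d _ cB]
  rw [support_hFamily_zero L w hw ϖ] at hν ⊢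
  rw [dOfPlace_eq_of_isRamifiedQuadraticDatum L w hw he hD, leviExp_laLow_mstarOfRecord d]
  have hq : Ideal.absNorm v.asIdeal = Fintype.card (Valued.ResidueField (w.1.adicCompletion L)) := by
    rw [Ideal.absNorm_apply, Submodule.cardQuot_apply]; exact natCard_quot_eq_card_residueField L w hw he
  have hq0 : (Fintype.card (Valued.ResidueField (w.1.adicCompletion L)) : ℂ) ≠ 0 := Nat.cast_ne_zero.2 Fintype.card_ne_zero
  rw [hq, measureReal_def]
  push_cast at hν ⊢
  rw [zpow_neg, zpow_natCast]
  field_simp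

/-- **(hnum-lev-hi) · THE ROW-(3) LETTER OF `stub_hside_levHi` AT THE ROW-(1) CONSTANT OF RECORD**: the third conjunct of ★ p859630 `hSideLevelsTripleS_hi_of_rows`'s `hrows`
(`(a, b) := (laHighOfRecord (dOfPlace L v w), mstarOfRecord (dOfPlace L v w))`) at `cA := νG₃(K)·2·q_w^{−klOfRecord d}`, every `cB` (exponent ★ p859652 `leviExp_laHigh_mstarOfRecord`).
[cite: Rogawski1990, §4.9 Prop. 4.9.1 (a)(b) p. 55, Lemma 4.9.2 p. 56] [cite: Kottwitz1986BaseChangeUnits, §1 pp. 240–241] -/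
theorem hnum_levHi_ofRecord
    (L : Type) [Field L] [NumberField L] [IsCMField L]
    {v : HeightOneSpectrum (𝓞 ↥(maximalRealSubfield L))} (w : UnitaryGroup.PlacesOver L v)
    (hw : IsCMField.complexConj L • w.1 = w.1) (he : v.asIdeal.ramificationIdx' w.1.asIdeal ≠ 1)
    (ϖ : (w.1.adicCompletion L)) (hϖ : Valued.v ϖ = WithZero.exp (-1 : ℤ)) (d tE : ℕ)
    (hD : IsRamifiedQuadraticDatum (galAdicCompletionMap (L := L) (IsCMField.complexConj L) hw) ϖ d tE)
    [Fintype (Valued.ResidueField (w.1.adicCompletion L))]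
    [MeasurableSpace ((UnitaryGroup.cmDatum L 3 (Matrix.of fun i j : Fin 3 => if i.val + j.val + 1 = 3 then (1 : L) else 0)).Local v)]
    [MeasurableSpace ((UnitaryGroup.cmDatum L 2 (Matrix.of fun i j : Fin 2 => if i.val + j.val + 1 = 2 then (1 : L) else 0)).Local v × (UnitaryGroup.cmDatum L 1 (Matrix.of fun i j : Fin 1 => if i.val + j.val + 1 = 1 then (1 : L) else 0)).Local v)] [BorelSpace ((UnitaryGroup.cmDatum L 2 (Matrix.of fun i j : Fin 2 => if i.val + j.val + 1 = 2 then (1 : L) else 0)).Local v × (UnitaryGroup.cmDatum L 1 (Matrix.of fun i j : Fin 1 => if i.val + j.val + 1 = 1 then (1 : L) else 0)).Local v)]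
    (νH : Measure ((UnitaryGroup.cmDatum L 2 (Matrix.of fun i j : Fin 2 => if i.val + j.val + 1 = 2 then (1 : L) else 0)).Local v × (UnitaryGroup.cmDatum L 1 (Matrix.of fun i j : Fin 1 => if i.val + j.val + 1 = 1 then (1 : L) else 0)).Local v)) [νH.IsHaarMeasure]
    (νG₃ : Measure ((UnitaryGroup.cmDatum L 3 (Matrix.of fun i j : Fin 3 => if i.val + j.val + 1 = 3 then (1 : L) else 0)).Local v)) (cB : ℂ) :
              ((fun s : Fin 2 => if ((s : Fin 2) : ℕ) = d % 2 then ((((νG₃ (cmLocalIntegralLevel L 3 (Matrix.of fun i j : Fin 3 => if i.val + j.val + 1 = 3 then (1 : L) else 0) v : Set ((UnitaryGroup.cmDatum L 3 (Matrix.of fun i j : Fin 3 => if i.val + j.val + 1 = 3 then (1 : L) else 0)).Local v))).toReal : ℂ) * ((2 * (Fintype.card (Valued.ResidueField (w.1.adicCompletion L)) : ℚ) ^ (-(klOfRecord d : ℤ)) : ℚ) : ℂ)) + cB) / (2 * (νH.real (Function.support (hFamily L w hw ϖ s)) : ℂ)) else -cB / (2 * (νH.real (Function.support (hFamily L w hw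 ϖ s)) : ℂ))) 0 * (νH.real (Function.support (hFamily L w hw ϖ 0)) : ℂ) + (fun s : Fin 2 => if ((s : Fin 2) : ℕ) = d % 2 then ((((νG₃ (cmLocalIntegralLevel L 3 (Matrix.of fun i j : Fin 3 => if i.val + j.val + 1 = 3 then (1 : L) else 0) v : Set ((UnitaryGroup.cmDatum L 3 (Matrix.of fun i j : Fin 3 => if i.val + j.val + 1 = 3 then (1 : L) else 0)).Local v))).toReal : ℂ) * ((2 * (Fintype.card (Valued.ResidueField (w.1.adicCompletion L)) : ℚ) ^ (-(klOfRecord d : ℤ)) : ℚ) : ℂ)) + cB) / (2 * (νH.real (Function.support (hFamily L w hw ϖ s)) : ℂ)) else -cB / (2 * (νH.real (Function.support (hFamily L w hw ϖ s)) : ℂ))) 1 * (νH.real (Function.support (hFamily L w hw ϖ 1)) : ℂ) =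
          ((((Ideal.absNorm v.asIdeal : ℝ) ^ ((max (max (laHighOfRecord (dOfPlace L v w)) (((mstarOfRecord (dOfPlace L v w)) + 1) / 2)) (((laHighOfRecord (dOfPlace L v w)) + d) / 2) - d / 2) + ((laHighOfRecord (dOfPlace L v w)) - d % 2 + 1) / 2))⁻¹) : ℂ) *
          (((νG₃.real (cmLocalIntegralLevel L 3 (Matrix.of fun i j : Fin 3 => if i.val + j.val + 1 = 3 then (1 : L) else 0) v : Set ((cmDatum L 3 (Matrix.of fun i j : Fin 3 => if i.val + j.val + 1 = 3 then (1 : L) else 0)).Local v)) : ℂ) /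
            (νH.real ((((cmLocalIntegralLevel L 2 (Matrix.of fun i j : Fin 2 => if i.val + j.val + 1 = 2 then (1 : L) else 0) v).prod
              (cmLocalIntegralLevel L 1 (Matrix.of fun i j : Fin 1 => if i.val + j.val + 1 = 1 then (1 : L) else 0) v) : Subgroup _) : Set _)) : ℂ)) *
          (νH.real (Function.support (hFamily L w hw ϖ 0)) : ℂ))) := by
  have hν := measureReal_support_hFamily_ne_zero L w hw he ϖ hϖ νH 0
  rw [coefAffine_rowThree_number_eq L w hw he ϖ hϖ νH d _ cB]
  rw [support_hFamily_zero L w hw ϖ] at hν ⊢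
  rw [dOfPlace_eq_of_isRamifiedQuadraticDatum L w hw he hD, leviExp_laHigh_mstarOfRecord d]
  have hq : Ideal.absNorm v.asIdeal = Fintype.card (Valued.ResidueField (w.1.adicCompletion L)) := by
    rw [Ideal.absNorm_apply, Submodule.cardQuot_apply]; exact natCard_quot_eq_card_residueField L w hw he
  have hq0 : (Fintype.card (Valued.ResidueField (w.1.adicCompletion L)) : ℂ) ≠ 0 := Nat.cast_ne_zero.2 Fintype.card_ne_zero
  rw [hq, measureReal_def]
  push_cast at hν ⊢
  rw [zpow_neg, zpow_natCast]
  field_simp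

/-- **(hnum-sq) · THE ROW-(3) LETTER OF `stub_hside_sq` AT THE ROW-(1) CONSTANT OF RECORD**: the third conjunct of ★ p859630 `hSideSqTripleS_of_rows`'s `hrows`
(`(a, b) := (0, mstarOfRecord (dOfPlace L v w))`) at `cA := νG₃(K)·2·q_w^{−csOfRecord d}`, every `cB` (exponent ★ p859652 `leviExp_zero_mstarOfRecord`).
[cite: Rogawski1990, §4.9 Prop. 4.9.1 (a)(b) p. 55, Lemma 4.9.2 p. 56] [cite: Kottwitz1986BaseChangeUnits, §1 pp. 240–241] -/
theorem hnum_sq_ofRecord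
    (L : Type) [Field L] [NumberField L] [IsCMField L]
    {v : HeightOneSpectrum (𝓞 ↥(maximalRealSubfield L))} (w : UnitaryGroup.PlacesOver L v)
    (hw : IsCMField.complexConj L • w.1 = w.1) (he : v.asIdeal.ramificationIdx' w.1.asIdeal ≠ 1)
    (ϖ : (w.1.adicCompletion L)) (hϖ : Valued.v ϖ = WithZero.exp (-1 : ℤ)) (d tE : ℕ)
    (hD : IsRamifiedQuadraticDatum (galAdicCompletionMap (L := L) (IsCMField.complexConj L) hw) ϖ d tE)
    [Fintype (Valued.ResidueField (w.1.adicCompletion L))]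
    [MeasurableSpace ((UnitaryGroup.cmDatum L 3 (Matrix.of fun i j : Fin 3 => if i.val + j.val + 1 = 3 then (1 : L) else 0)).Local v)]
    [MeasurableSpace ((UnitaryGroup.cmDatum L 2 (Matrix.of fun i j : Fin 2 => if i.val + j.val + 1 = 2 then (1 : L) else 0)).Local v × (UnitaryGroup.cmDatum L 1 (Matrix.of fun i j : Fin 1 => if i.val + j.val + 1 = 1 then (1 : L) else 0)).Local v)] [BorelSpace ((UnitaryGroup.cmDatum L 2 (Matrix.of fun i j : Fin 2 => if i.val + j.val + 1 = 2 then (1 : L) else 0)).Local v × (UnitaryGroup.cmDatum L 1 (Matrix.of fun i j : Fin 1 => if i.val + j.val + 1 = 1 then (1 : L) else 0)).Local v)]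
    (νH : Measure ((UnitaryGroup.cmDatum L 2 (Matrix.of fun i j : Fin 2 => if i.val + j.val + 1 = 2 then (1 : L) else 0)).Local v × (UnitaryGroup.cmDatum L 1 (Matrix.of fun i j : Fin 1 => if i.val + j.val + 1 = 1 then (1 : L) else 0)).Local v)) [νH.IsHaarMeasure]
    (νG₃ : Measure ((UnitaryGroup.cmDatum L 3 (Matrix.of fun i j : Fin 3 => if i.val + j.val + 1 = 3 then (1 : L) else 0)).Local v)) (cB : ℂ) :
              ((fun s : Fin 2 => if ((s : Fin 2) : ℕ) = d % 2 then ((((νG₃ (cmLocalIntegralLevel L 3 (Matrix.of fun i j : Fin 3 => if i.val + j.val + 1 = 3 then (1 : L) else 0) v : Set ((UnitaryGroup.cmDatum L 3 (Matrix.of fun i j : Fin 3 => if i.val + j.val + 1 = 3 then (1 : L) else 0)).Local v))).toReal : ℂ) * ((2 * (Fintype.card (Valued.ResidueField (w.1.adicCompletion L)) : ℚ) ^ (-(csOfRecord d : ℤ)) : ℚ) : ℂ)) + cB) / (2 * (νH.real (Function.support (hFamily L w hw ϖ s)) : ℂ)) else -cB / (2 * (νH.real (Function.support (hFamily L w hw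 ϖ s)) : ℂ))) 0 * (νH.real (Function.support (hFamily L w hw ϖ 0)) : ℂ) + (fun s : Fin 2 => if ((s : Fin 2) : ℕ) = d % 2 then ((((νG₃ (cmLocalIntegralLevel L 3 (Matrix.of fun i j : Fin 3 => if i.val + j.val + 1 = 3 then (1 : L) else 0) v : Set ((UnitaryGroup.cmDatum L 3 (Matrix.of fun i j : Fin 3 => if i.val + j.val + 1 = 3 then (1 : L) else 0)).Local v))).toReal : ℂ) * ((2 * (Fintype.card (Valued.ResidueField (w.1.adicCompletion L)) : ℚ) ^ (-(csOfRecord d : ℤ)) : ℚ) : ℂ)) + cB) / (2 * (νH.real (Function.support (hFamily L w hw ϖ s)) : ℂ)) else -cB / (2 * (νH.real (Function.support (hFamily L w hw ϖ s)) : ℂ))) 1 * (νH.real (Function.support (hFamily L w hw ϖ 1)) : ℂ) =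
          ((((Ideal.absNorm v.asIdeal : ℝ) ^ ((max (max 0 (((mstarOfRecord (dOfPlace L v w)) + 1) / 2)) ((0 + d) / 2) - d / 2) + (0 - d % 2 + 1) / 2))⁻¹) : ℂ) *
          (((νG₃.real (cmLocalIntegralLevel L 3 (Matrix.of fun i j : Fin 3 => if i.val + j.val + 1 = 3 then (1 : L) else 0) v : Set ((cmDatum L 3 (Matrix.of fun i j : Fin 3 => if i.val + j.val + 1 = 3 then (1 : L) else 0)).Local v)) : ℂ) /
            (νH.real ((((cmLocalIntegralLevel L 2 (Matrix.of fun i j : Fin 2 => if i.val + j.val + 1 = 2 then (1 : L) else 0) v).prod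
              (cmLocalIntegralLevel L 1 (Matrix.of fun i j : Fin 1 => if i.val + j.val + 1 = 1 then (1 : L) else 0) v) : Subgroup _) : Set _)) : ℂ)) *
          (νH.real (Function.support (hFamily L w hw ϖ 0)) : ℂ))) := by
  have hν := measureReal_support_hFamily_ne_zero L w hw he ϖ hϖ νH 0
  rw [coefAffine_rowThree_number_eq L w hw he ϖ hϖ νH d _ cB]
  rw [support_hFamily_zero L w hw ϖ] at hν ⊢
  rw [dOfPlace_eq_of_isRamifiedQuadraticDatum L w hw he hD, leviExp_zero_mstarOfRecord d]
  have hq : Ideal.absNorm v.asIdeal = Fintype.card (Valued.ResidueField (w.1.adicCompletion L)) := by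
    rw [Ideal.absNorm_apply, Submodule.cardQuot_apply]; exact natCard_quot_eq_card_residueField L w hw he
  have hq0 : (Fintype.card (Valued.ResidueField (w.1.adicCompletion L)) : ℂ) ≠ 0 := Nat.cast_ne_zero.2 Fintype.card_ne_zero
  rw [hq, measureReal_def]
  push_cast at hν ⊢
  rw [zpow_neg, zpow_natCast]
  field_simp

end Summit.HodgeConjecture.HodgeConjecture.Cruxes.H413.F0P3cDyRamHSideRowThreeLettersOfRecord

end
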